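import Summits.Ventures.PercRepro.S1CoreCapSpec
import Summits.Ventures.PercRepro.S1CoreCapSpecThree
import Summits.Ventures.PercRepro.S1CoreCapSpecFourMain

/-!
# PercRepro — THE PLANE-POOR SPEC of the per-point four-circuit table (p1, gen 34)

`proofs/P1-S2-CORANK6.md` §4n. The plane-poor 8-spread per-point table of `S1FiveCircuitsSolidSkeleton` («every
finite plane-poor 8-spread matroid of nullity `j` has at most `tPoor j` four-circuits through each point») is, on
the configuration of a point `f` (the lines of `M ／ {f}` carrying the 4-circuits through `f`, `S1CoreCapClasses`),
an instance of the 4-circuit-cap spec with STRONGER clauses: every line has total weight `≤ 4` (a plane through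
`f` of `≤ 5` points), a sub-family of rank bound `≤ 2` has weight `≤ 5` and one of rank bound `≤ 3` has weight
`≤ 6` (the 8-spread clause, `S1PoorCapRank`), and the cap table is `capPoor = 1 / 4 / 2` on the shapes
`(3, 0) / (4, 0) / (3, 1)` (the only shapes of weight `≤ 4` with `≥ 3` classes). `FourCapSpecPoor cap ν Q` is that
spec. Since its clauses imply those of `FourCapSpec` (for `ν ≤ 16`) and `capPoor ≤ capPaper` pointwise, the landed
instances `fourCapSpec_three` (`Q = 5`) and `fourCapSpec_four` (`Q = 8`) give the table's values `t(3) = 5` and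
`t(4) = 8` at once (`fourCapSpecPoor_three`, `fourCapSpecPoor_four`); the values `t(5) = 9` and `t(6) = 12` of
the search (`mining/tpoor`) need the stronger clauses and are NOT here. Nothing in this file is about matroids.
Axioms: standard.
-/

namespace PercRepro

namespace S1

namespace FourCap

variable {β : Type} [DecidableEq β]

/-- **The plane-poor cap table** `capPoor k f` for a line of `k` classes of which `f` are fat: `1 / 4 / 2` on the
three shapes `(3, 0) / (4, 0) / (3, 1)` of weight `≤ 4`, and `0` elsewhere. -/
def capPoor (k f : ℕ) : ℕ :=
  match k, f with
  | 3, 0 => 1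
  | 4, 0 => 4
  | 3, 1 => 2
  | _, _ => 0

/-- The values of the plane-poor table at its three shapes. -/
theorem capPoor_values : capPoor 3 0 = 1 ∧ capPoor 4 0 = 4 ∧ capPoor 3 1 = 2 := by decide

/-- `capPoor ≤ capPaper` pointwise. -/
theorem capPoor_le_capPaper (k f : ℕ) : capPoor k f ≤ capPaper k f := by
  rcases k with _ | _ | _ | _ | _ | _ | k <;> rcases f with _ | _ | _ | f <;> simp [capPoor, capPaper]

/-- **THE PLANE-POOR SPEC** at nullity `ν` with answer `Q`, for a cap table `cap`: on every configuration of
weighted classes (weights `1` or `2`) whose lines have `≥ 3` classes of total weight `≤ 4`, meet pairwise in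
`≤ 1` class, and satisfy the cost clause (`wsum (unionL l) ≤ ν + lineRank l` for every sub-list `l`) and the
spread clauses (`lineRank l ≤ 2 ⟹ wsum (unionL l) ≤ 5`, `lineRank l ≤ 3 ⟹ wsum (unionL l) ≤ 6`), the caps
sum to at most `Q`. -/
def FourCapSpecPoor (cap : ℕ → ℕ → ℕ) (ν Q : ℕ) : Prop :=
  ∀ (β : Type) [DecidableEq β] (w : β → ℕ) (ls : Finset (Finset β)),
    (∀ L ∈ ls, ∀ v ∈ L, w v = 1 ∨ w v = 2) →
    (∀ L ∈ ls, 3 ≤ L.card ∧ wsum w L ≤ 4) →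
    (∀ L ∈ ls, ∀ L' ∈ ls, L ≠ L' → (L ∩ L').card ≤ 1) →
    (∀ l : List (Finset β), l.Nodup → (∀ L ∈ l, L ∈ ls) → wsum w (unionL l) ≤ ν + lineRank l) →
    (∀ l : List (Finset β), l.Nodup → (∀ L ∈ l, L ∈ ls) → lineRank l ≤ 2 → wsum w (unionL l) ≤ 5) →
    (∀ l : List (Finset β), l.Nodup → (∀ L ∈ l, L ∈ ls) → lineRank l ≤ 3 → wsum w (unionL l) ≤ 6) →
    ∑ L ∈ ls, cap L.card (fat w L) ≤ Q

/-- A pointwise smaller cap table inherits the plane-poor spec. -/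
theorem FourCapSpecPoor.mono {cap cap' : ℕ → ℕ → ℕ} (hle : ∀ k f, cap k f ≤ cap' k f) {ν Q : ℕ}
    (h : FourCapSpecPoor cap' ν Q) : FourCapSpecPoor cap ν Q := by
  intro β _ w ls h1 h2 h3 h4 h5 h6
  exact (Finset.sum_le_sum (fun L _ => hle L.card (fat w L))).trans (h β w ls h1 h2 h3 h4 h5 h6)

/-- A larger answer inherits the plane-poor spec. -/
theorem FourCapSpecPoor.mono_right {cap : ℕ → ℕ → ℕ} {ν Q Q' : ℕ} (hQ : Q ≤ Q') (h : FourCapSpecPoor cap ν Q) :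
    FourCapSpecPoor cap ν Q' := by
  intro β _ w ls h1 h2 h3 h4 h5 h6
  exact (h β w ls h1 h2 h3 h4 h5 h6).trans hQ

/-- A smaller nullity inherits the plane-poor spec (the cost clause relaxes). -/
theorem FourCapSpecPoor.mono_nullity {cap : ℕ → ℕ → ℕ} {ν ν' Q : ℕ} (hν : ν ≤ ν') (h : FourCapSpecPoor cap ν' Q) :
    FourCapSpecPoor cap ν Q := by
  intro β _ w ls h1 h2 h3 h4 h5 h6
  exact h β w ls h1 h2 h3 (fun l hl hls => (h4 l hl hls).trans (by omega)) h5 h6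

/-- Every class of a sub-family has weight `1` or `2`. -/
theorem weight_of_mem_unionL {w : β → ℕ} {ls : Finset (Finset β)}
    (h1 : ∀ L ∈ ls, ∀ v ∈ L, w v = 1 ∨ w v = 2) {l : List (Finset β)} (hls : ∀ L ∈ l, L ∈ ls) :
    ∀ v ∈ unionL l, w v = 1 ∨ w v = 2 := by
  intro v hv
  obtain ⟨L, hL, hvL⟩ := mem_unionL_iff.1 hv
  exact h1 L (hls L hL) v hvL

/-- **The plain spec implies the plane-poor spec** (for `ν ≤ 16`): the plane-poor clauses are stronger — lines of
weight `≤ 4` have weight `≤ 5`, a sub-family of rank bound `≤ 3` of weight `≤ 6` has `≤ 9` classes, and one of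
rank bound `≤ 4` has `≤ ν + 4 ≤ 20` classes by the cost clause. -/
theorem FourCapSpecPoor.of_fourCapSpec {cap : ℕ → ℕ → ℕ} {ν Q : ℕ} (h : FourCapSpec cap ν Q) (hν : ν ≤ 16) :
    FourCapSpecPoor cap ν Q := by
  intro β _ w ls h1 h2 h3 h4 h5 h6
  refine h β w ls h1 (fun L hL => ⟨(h2 L hL).1, (h2 L hL).2.trans (by decide)⟩) h3 h4 ?_ ?_
  · intro l hl hls hr
    exact (card_le_wsum w _ (weight_of_mem_unionL h1 hls)).trans ((h6 l hl hls hr).trans (by decide))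
  · intro l hl hls hr
    exact (card_le_wsum w _ (weight_of_mem_unionL h1 hls)).trans ((h4 l hl hls).trans (by omega))

/-- **The plane-poor spec at nullity `0`**: `Q = 0`. -/
theorem fourCapSpecPoor_zero : FourCapSpecPoor capPoor 0 0 :=
  (FourCapSpecPoor.of_fourCapSpec fourCapSpec_zero (by decide)).mono capPoor_le_capPaper

/-- **The plane-poor spec at nullity `1`**: `Q = 1`. -/
theorem fourCapSpecPoor_one : FourCapSpecPoor capPoor 1 1 :=
  (FourCapSpecPoor.of_fourCapSpec fourCapSpec_one (by decide)).mono capPoor_le_capPaper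

/-- **The plane-poor spec at nullity `2`**: `Q = 4`. -/
theorem fourCapSpecPoor_two : FourCapSpecPoor capPoor 2 4 :=
  (FourCapSpecPoor.of_fourCapSpec fourCapSpec_two (by decide)).mono capPoor_le_capPaper

/-- **THE TABLE'S VALUE `t(3) = 5` AS AN ABSTRACT FACT**: the plane-poor spec at nullity `3` with `Q = 5`, from
the landed plain instance `fourCapSpec_three`. -/
theorem fourCapSpecPoor_three : FourCapSpecPoor capPoor 3 5 :=
  (FourCapSpecPoor.of_fourCapSpec fourCapSpec_three (by decide)).mono capPoor_le_capPaper

/-- **THE TABLE'S VALUE `t(4) = 8` AS AN ABSTRACT FACT**: the plane-poor spec at nullity `4` with `Q = 8`, from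
the landed plain instance `fourCapSpec_four`. -/
theorem fourCapSpecPoor_four : FourCapSpecPoor capPoor 4 8 :=
  (FourCapSpecPoor.of_fourCapSpec fourCapSpec_four (by decide)).mono capPoor_le_capPaper

end FourCap

end S1

end PercRepro
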